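import Mathlib
import Summits.Ventures.LatticeQCDFlow.Scaling.CrossCutFloorUniformR
import Summits.Ventures.LatticeQCDFlow.Scaling.DefectVarianceFloor
import Summits.Ventures.LatticeQCDFlow.Scaling.UNOneLink

/-!
# LatticeQCDFlow / Scaling — (LC) AT EVERY SEPARATION, (U′) FOR EVERY `R` AND (U″) AT STRONG
# COUPLING, AND THE EXPLICIT DEFECT-VARIANCE FLOOR, FOR `U(N)` LATTICE GAUGE THEORY, EVERY `N ≥ 1`

HONEST FRAMING: exact (Metropolis-corrected) sampling algorithms for lattice gauge theory;
figures of merit are autocorrelation/cost numbers at stated couplings and volumes; no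
continuum-physics claim.

Venture `LatticeQCDFlow` (cell pub-lqcd), topic `Scaling`, FANOUT row 30 (lean-1 GEN-12) — OUR WORK, the
`U(N)` instance file.  Gens 9–11 proved, for every compact gauge group with one-link data
`GroupLayer.OneLink ρ θ`: (LC) with leading tube `N θ^{4t+1} β^{4t}`
(`GroupCrossCutFloorAllT.torusTruncC_leadingCoeff`), (U′) at strong coupling for every `R`
(`crossCutCorrelatorFloor_of_oneLink`), (U″) along every transverse axis
(`Clustering.clusteringFloor_of_oneLink_transverse`) with (U′) uniform in `R`
(`Clustering.crossCutCorrelatorFloor_allR_of_oneLink`), and the defect-variance floor with constant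
`Var_Haar(Re tr ρ)` (`DefectFloor.defect_variance_floor`).  `UNOneLink.oneLink_unitaryFundamentalRep`
supplies the data for `G = U(N)` (`Matrix.unitaryGroup (Fin N) ℂ`, defining representation
`unitaryFundamentalRep (Fin N) ℂ`), `θ = 1/(2N)`, every `N ≥ 1`.  Hence, with NO physics input:

* **`torusTruncC_leadingCoeff_un`** — (LC): the truncated torus correlator of two parallel `U(N)`
  plaquettes `Re tr U_p` stacked `t ≥ 1` apart is `2^{-(4t+1)} N^{-4t} β^{4t} + O(β^{4t+1})` on every
  torus of side `≥ max 3 (2t) + 1` — for EVERY `N ≥ 1` (at `N = 1` this is gen-9's `2^{-(4t+1)}`; the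
  `SU(N)` shape `2^{-(4t+1)} N^{-4t}` needs `N ≥ 3` there, `SU(2)` being `2^{-4t}`);
* **`crossCutCorrelatorFloor_un`**, `crossCutCorrelatorFloorR_un` — (U′) at strong coupling for every
  `R`: `∃ β₀ > 0, ∀ β ≠ 0, |β| ≤ β₀ → Conjectures.CrossCutCorrelatorFloor d N U(N) ρ β R i j a`
  (`i < j`, `a ∉ {i, j}`);
* **`clusteringFloor_un_transverse`** — (U″) at strong coupling along every transverse axis:
  `∃ β₀ > 0, ∀ β ∈ (0, β₀], Conjectures.ClusteringFloor d N U(N) ρ β i j a`, and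
  `crossCutCorrelatorFloor_allR_un` — (U′) for every `R` inside ONE window;
* **`defect_variance_floor_un`** — with lean-2's `un_variance_re_trace` (`Var_Haar(Re tr) = 1/2`), the
  explicit defect specific-heat floor `e^{−8N(d−1)B} · #D/(8d(d−1)+1) · 1/2 ≤ Var[S_D]` under every
  defect-tilted `U(N)` Wilson measure, every `D`, `L ≥ 2`, `|β|, |u| ≤ B`.

NOT CLAIMED: intermediate `β`; in-plane axes at strong coupling; other representations of `U(N)`.
Elementary given the imports; nothing is cited as a fact; no `def`, no `sorry`.
-/

noncomputable section

open MeasureTheory ProbabilityTheory Filter Topology Asymptotics Finset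
open Literature.MathematicalPhysics.QuantumFieldTheory
open Literature.MathematicalPhysics.QuantumLattice (plaquetteObs unitaryFundamentalRep
  unitaryFundamentalRep_apply continuous_unitaryFundamentalRep)
open Summit.Ventures.LatticeQCDFlow.TrivializingMaps (unitaryGroup_secondCountableTopology
  un_variance_re_trace)

namespace Summit.Ventures.LatticeQCDFlow.Theory2.GroupLayer

variable {d N : ℕ} {a i j : Fin d}

/-! ## §1 (LC) and (U′) at strong coupling for `U(N)` -/

/-- **(U′) AT STRONG COUPLING FOR `U(N)`, EVERY `N ≥ 1`, EVERY `R`.**  For `d`-dimensional `U(N)`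
lattice gauge theory in the defining representation (`i < j`, `a ∉ {i, j}`) and every `R`: there is
`β₀ > 0` such that for every real `β ≠ 0` with `|β| ≤ β₀` the venture's cross-cut correlator floor
`Conjectures.CrossCutCorrelatorFloor d N U(N) ρ β R i j a` holds. -/
theorem crossCutCorrelatorFloor_un (hN : 1 ≤ N) (hij : i < j) (hai : a ≠ i) (haj : a ≠ j) (R : ℕ) :
    ∃ β₀ : ℝ, 0 < β₀ ∧ ∀ β : ℝ, β ≠ 0 → |β| ≤ β₀ →
      Conjectures.CrossCutCorrelatorFloor d N (Matrix.unitaryGroup (Fin N) ℂ)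
        (unitaryFundamentalRep (Fin N) ℂ) β R i j a := by
  haveI := unitaryGroup_secondCountableTopology (N := N)
  haveI : NeZero N := ⟨by omega⟩
  exact crossCutCorrelatorFloor_of_oneLink (oneLink_unitaryFundamentalRep hN) hij hai haj R

/-- **The repaired item (U′-R) at strong coupling for `U(N)`, every `N ≥ 1`, every `R`.** [folklore] -/
theorem crossCutCorrelatorFloorR_un (hN : 1 ≤ N) (hij : i < j) (hai : a ≠ i) (haj : a ≠ j) (R : ℕ) :
    ∃ β₀ : ℝ, 0 < β₀ ∧ ∀ β : ℝ, β ≠ 0 → |β| ≤ β₀ →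
      Conjectures.CrossCutCorrelatorFloorR d N (Matrix.unitaryGroup (Fin N) ℂ)
        (unitaryFundamentalRep (Fin N) ℂ) β R i j a := by
  haveI := unitaryGroup_secondCountableTopology (N := N)
  haveI : NeZero N := ⟨by omega⟩
  exact crossCutCorrelatorFloorR_of_oneLink (oneLink_unitaryFundamentalRep hN) hij hai haj R

/-- **(LC) AT EVERY SEPARATION FOR `U(N)`, EVERY `N ≥ 1`** — the leading tube: on the torus of side
`L + 1` with `L ≥ max 3 (2t)`, the truncated correlator of two parallel plaquettes `Re tr U_p` in the
`(i, j)` plane stacked `t ≥ 1` units apart along `a ∉ {i, j}` is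
`2^{-(4t+1)} N^{-4t} β^{4t} + O(β^{4t+1})` at `β = 0`. -/
theorem torusTruncC_leadingCoeff_un (hN : 1 ≤ N) (hij : i < j) (hai : a ≠ i) (haj : a ≠ j)
    {t : ℕ} (ht : 1 ≤ t) (L : ℕ) (hL3 : 3 ≤ L) (hLt : 2 * t ≤ L) :
    (fun β : ℂ => torusTruncC (unitaryFundamentalRep (Fin N) ℂ) (L + 1)
        (plaquetteObs (unitaryFundamentalRep (Fin N) ℂ) 0 i j)
        (plaquetteObs (unitaryFundamentalRep (Fin N) ℂ) 0 i j) (Pi.single a (t : ℤ)) β -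
        ((((2 : ℝ) ^ (4 * t + 1))⁻¹ * ((N : ℝ) ^ (4 * t))⁻¹ : ℝ) : ℂ) * β ^ (4 * t))
      =O[𝓝 (0 : ℂ)] fun β => β ^ (4 * t + 1) := by
  haveI := unitaryGroup_secondCountableTopology (N := N)
  have h := torusTruncC_leadingCoeff (oneLink_unitaryFundamentalRep hN) hij hai haj ht L hL3 hLt
  have hN0 : (N : ℝ) ≠ 0 := Nat.cast_ne_zero.2 (by omega)
  have hb : (N : ℝ) * (1 / (2 * N)) ^ (4 * t + 1) =
      ((2 : ℝ) ^ (4 * t + 1))⁻¹ * ((N : ℝ) ^ (4 * t))⁻¹ := by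
    rw [one_div, mul_inv, mul_pow, inv_pow, inv_pow, pow_succ (N : ℝ) (4 * t), mul_inv]
    field_simp
  rw [hb] at h
  exact h

/-! ## §2 (U″) at strong coupling along every transverse axis; (U′) uniform in `R` -/

/-- **(U″) AT STRONG COUPLING FOR `U(N)`, EVERY `N ≥ 1`, EVERY PLANE `i ≠ j`, EVERY TRANSVERSE AXIS
`a ∉ {i, j}`**: `∃ β₀ > 0, ∀ β ∈ (0, β₀], Conjectures.ClusteringFloor d N U(N) ρ β i j a`
(reflection positivity ⇒ log-convexity, gen-11, on top of (U′) at `R = 0`). -/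
theorem clusteringFloor_un_transverse (hN : 1 ≤ N) (hij : i ≠ j) (hai : a ≠ i) (haj : a ≠ j) :
    ∃ β₀ : ℝ, 0 < β₀ ∧ ∀ β : ℝ, 0 < β → β ≤ β₀ →
      Conjectures.ClusteringFloor d N (Matrix.unitaryGroup (Fin N) ℂ)
        (unitaryFundamentalRep (Fin N) ℂ) β i j a := by
  haveI := unitaryGroup_secondCountableTopology (N := N)
  haveI : NeZero N := ⟨by omega⟩
  by_cases hd : d = 0
  · subst hd; exact i.elim0
  haveI : NeZero d := ⟨hd⟩
  exact Clustering.clusteringFloor_of_oneLink_transverse (unitaryFundamentalRep (Fin N) ℂ)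
    (oneLink_unitaryFundamentalRep hN) hij hai haj

/-- **`U(N)`: (U′) for EVERY `R` inside ONE strong-coupling window.** -/
theorem crossCutCorrelatorFloor_allR_un (hN : 1 ≤ N) (hij : i ≠ j) (hai : a ≠ i) (haj : a ≠ j) :
    ∃ β₀ : ℝ, 0 < β₀ ∧ ∀ β : ℝ, 0 < β → β ≤ β₀ → ∀ R : ℕ,
      Conjectures.CrossCutCorrelatorFloor d N (Matrix.unitaryGroup (Fin N) ℂ)
        (unitaryFundamentalRep (Fin N) ℂ) β R i j a := by
  obtain ⟨β₀, hβ₀, hcl⟩ := clusteringFloor_un_transverse (d := d) hN hij hai haj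
  exact ⟨β₀, hβ₀, fun β hβ hle R =>
    Clustering.crossCutCorrelatorFloor_of_clusteringFloor (unitaryFundamentalRep (Fin N) ℂ)
      (hcl β hβ hle) R⟩

/-! ## §3 The explicit defect-variance floor for `U(N)` -/

/-- **THE DEFECT SPECIFIC-HEAT FLOOR FOR `U(N)`, EXPLICIT CONSTANT** (every `N ≥ 1`, `L ≥ 2`, `d`,
every finite set `D` of plaquettes, `|β|, |u| ≤ B`):
`e^{−8N(d−1)B} · #D/(8d(d−1)+1) · 1/2 ≤ Var[Σ_{p∈D}(N − Re tr U_p); (⊗Haar).tilted(−(β S_{Dᶜ} + u S_D))]`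
— gen-11's `DefectFloor.defect_variance_floor` with lean-2's `Var_Haar(Re tr) = 1/2`. -/
theorem defect_variance_floor_un {L : ℕ} [NeZero L] (hN : 1 ≤ N) (hL : 2 ≤ L) {β u B : ℝ}
    (hβ : |β| ≤ B) (hu : |u| ≤ B) (D : Finset (Plaquette d L)) :
    Real.exp (-(8 * N * ((d - 1 : ℕ) : ℝ) * B)) * ((D.card : ℝ) / ((8 * d * (d - 1) + 1 : ℕ) : ℝ))
        * (1 / 2)
      ≤ variance (fun U : GaugeConfig d L (Matrix.unitaryGroup (Fin N) ℂ) =>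
            ∑ p ∈ D, ((N : ℝ)
              - (unitaryFundamentalRep (Fin N) ℂ (plaquetteHolonomy U p.1 p.2.1.1 p.2.1.2)).trace.re))
          ((Measure.pi fun _ : Edge d L => haarProbability (Matrix.unitaryGroup (Fin N) ℂ)).tilted
            fun U => -(β * (∑ p ∈ Dᶜ, ((N : ℝ)
                - (unitaryFundamentalRep (Fin N) ℂ (plaquetteHolonomy U p.1 p.2.1.1 p.2.1.2)).trace.re))
              + u * (∑ p ∈ D, ((N : ℝ)
                - (unitaryFundamentalRep (Fin N) ℂ
                    (plaquetteHolonomy U p.1 p.2.1.1 p.2.1.2)).trace.re)))) := by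
  haveI := unitaryGroup_secondCountableTopology (N := N)
  have h := DefectFloor.defect_variance_floor (unitaryFundamentalRep (Fin N) ℂ) hL
    (continuous_unitaryFundamentalRep (Fin N) ℂ) hβ hu D
  rw [un_variance_re_trace hN] at h
  exact h

end Summit.Ventures.LatticeQCDFlow.Theory2.GroupLayer

end
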